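import Summits.Ventures.Crystal3D.Theorems.StickyWulffConstantGenericWallFloorOfP5Exhaustion
import Summits.Ventures.Crystal3D.Theorems.StickyWulffConstantGenericWallFloorStarTransport
import Summits.Ventures.Crystal3D.Theorems.StickyWulffConstantCoaxialWallLawTwinReaderRigidity
import HarnessLib

/-!
# A saturated ball over a slot star closes into its lattice: the twelve contacts are the slot dozen or a twin dozen whose
# mirror balls cap slot triangles (lane F T5b, multi-piece split: the «E1 cap row» for thin pieces; crux `CoaxialWallLaw`)

HONEST FRAMING. Venture `Summits/Ventures/Crystal3D` (cell `crystal3d-full`), helper `--supports` the crux `CoaxialWallLaw`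
(stmt-Ventures-19481, `route-Ventures-StickyWulffConstant`), lane F 'Certificates' v8.1, registered stub `stub_incoherentSeamSmall`
(proof architecture of record: the MULTI-PIECE SPLIT, cf-p1 (ccxl); items (M1)–(M4)).  CONDITIONAL on the registered computational
fact `P5Exhaustion` (`stub_E1`, the E1 row C12-55: the closed vertex star is exact-only).  Pure finite geometry; F-C1 not moved.

THE POINT (19481-p1 g18 crowding numerics j333536/j333565: six pairwise ball-disjoint exact 13-clusters can each own a contact of one
payer, so the split cannot bound foreign pieces by COUNTING them; what bounds a thin foreign piece is that its balls near the payer KEEP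
DEFICIENCY).  Let `y` be a ball of a `1`-separated configuration `X` whose contacts contain the CLOSED VERTEX STAR
`{y + A w : ⟪w, δ⟫ > 0}` of a slot `δ` in a frame `A` — e.g. `y` is a dozen ball of an exact reader `q = y + A δ` of the lattice
`y + A·Λ₀` (the star is `q` and the four common neighbours of `y` and `q`).  IF `y` IS SATURATED (twelve contacts) then, by E1 and
slot-dozen rigidity (`fccDozen_eq_slots_of_three_independent` / `hcpDozen_twin_of_three_independent`, …SlotDozens):
* `shell_slots_or_twin_of_star_twelve` — the twelve contacts of `y` are EITHER the slot dozen `{y + A w : w ∈ fccSlots}` OR a twin dozen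
  `{y + A w : ⟪A w, n⟫ ≤ 0} ∪ {y + A w − 2⟪A w, n⟫ n : ⟪A w, n⟫ < 0}` for a menu normal `n` of `A`;
* `dist_mirror_slot_eq_one` — a mirrored member `y + A w − 2⟪A w, n⟫ n` touches `y + A h` for every in-plane slot `h` adjacent to `w`;
* **`contact_slot_or_caps_of_star_twelve`** — hence EVERY contact of `y` is a slot ball `y + A w` or CAPS A SLOT TRIANGLE: it touches two
  occupied in-plane slot balls `y + A h₁`, `y + A h₂` with `⟪h₁, h₂⟫ = ½` (the unit triangle `{y, y + A h₁, y + A h₂} ⊆ X`).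
CONSEQUENCE for the pieces of (M1) (to be instantiated against '…SeamPiecesDefs' when it lands): a piece contains its occupied lattice
sites and is closed under capping unit triangles of its balls, so a SITE ball of a piece carrying a slot star of the piece's frame and
having twelve contacts has ALL TWELVE in the piece — contrapositively a piece ball with `≤ 11` piece-contacts over a star has `≤ 11`
contacts in `X`: junk heals at most `11 − deg_piece`, every such ball keeps deficiency `≥ 1` (the E1 cap row; the thin-piece pools of
a lone exact cluster are `≥ 5` at each of its dozen balls near the payer).
WHAT THIS IS NOT: not `P5Exhaustion` (taken as hypothesis); no statement about pieces/cores (their Defs are 19481-p2's); F-C1 not moved.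
-/

noncomputable section

namespace Summit.Ventures.Crystal3D.Theorems

open Finset Literature.Geometry.DiscreteGeometry
open Literature.MathematicalPhysics.StatisticalMechanics (fccStacking)
open scoped InnerProductSpace

/-- **A mirrored twin member touches the in-plane slots adjacent to its slot**: for a unit `n`, a slot `w` and an in-plane slot `h`
(`⟪A h, n⟫ = 0`) adjacent to `w` (`⟪w, h⟫ = ½`), `dist (y + (A w − 2⟪A w, n⟫ n)) (y + A h) = 1`. -/
theorem dist_mirror_slot_eq_one (A : EuclideanSpace ℝ (Fin 3) ≃ₗᵢ[ℝ] EuclideanSpace ℝ (Fin 3)) (y : EuclideanSpace ℝ (Fin 3))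
    {n : EuclideanSpace ℝ (Fin 3)} (hn : ‖n‖ = 1) {w h : EuclideanSpace ℝ (Fin 3)} (hw : w ∈ fccSlots) (hh : h ∈ fccSlots)
    (hwh : ⟪w, h⟫_ℝ = 1 / 2) (hhn : ⟪A h, n⟫_ℝ = 0) :
    dist (y + (A w - (2 * ⟪A w, n⟫_ℝ) • n)) (y + A h) = 1 := by
  have hw1 : ⟪A w, A w⟫_ℝ = 1 := by
    rw [real_inner_self_eq_norm_sq, LinearIsometryEquiv.norm_map, norm_eq_one_of_mem_fccSlots hw, one_pow]
  have hh1 : ⟪A h, A h⟫_ℝ = 1 := by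
    rw [real_inner_self_eq_norm_sq, LinearIsometryEquiv.norm_map, norm_eq_one_of_mem_fccSlots hh, one_pow]
  have hwh' : ⟪A w, A h⟫_ℝ = 1 / 2 := by rw [LinearIsometryEquiv.inner_map_map, hwh]
  have hwh'' : ⟪A h, A w⟫_ℝ = 1 / 2 := by rw [real_inner_comm, hwh']
  have hhn' : ⟪n, A h⟫_ℝ = 0 := by rw [real_inner_comm, hhn]
  have hnn : ⟪n, n⟫_ℝ = 1 := by rw [real_inner_self_eq_norm_sq, hn, one_pow]
  set t : ℝ := ⟪A w, n⟫_ℝ with ht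
  have ht' : ⟪n, A w⟫_ℝ = t := by rw [real_inner_comm]
  have e : y + (A w - (2 * t) • n) - (y + A h) = A w - A h - (2 * t) • n := by abel
  rw [dist_eq_norm, e]
  have hsq : ‖A w - A h - (2 * t) • n‖ ^ 2 = 1 := by
    rw [← real_inner_self_eq_norm_sq]
    simp only [inner_sub_left, inner_sub_right, inner_smul_left, inner_smul_right, hw1, hh1, hwh', hwh'', hhn, hhn',
      ht', hnn, RCLike.conj_to_real]
    rw [← ht]
    ring
  have h1 : ‖A w - A h - (2 * t) • n‖ ^ 2 = 1 ^ 2 := by rw [hsq, one_pow]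
  exact (sq_eq_sq₀ (norm_nonneg _) zero_le_one).1 h1

/-- **THE SHELL OF A SATURATED BALL OVER A SLOT STAR (E1 + slot-dozen rigidity).**  `X` `1`-separated, `y ∈ X`, the closed vertex star
of the slot `δ` in the frame `A` occupied around `y`, and `y` has twelve contacts.  Then the contact shell of `y` is the slot dozen of `A`
at `y`, or a twin dozen of it for some menu normal `n` of `A`. -/
theorem shell_slots_or_twin_of_star_twelve (hE1 : P5Exhaustion)
    (A : EuclideanSpace ℝ (Fin 3) ≃ₗᵢ[ℝ] EuclideanSpace ℝ (Fin 3)) {X : Finset (EuclideanSpace ℝ (Fin 3))}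
    (hX : ∀ p ∈ X, ∀ q ∈ X, p ≠ q → 1 ≤ dist p q) {y : EuclideanSpace ℝ (Fin 3)}
    {δ : EuclideanSpace ℝ (Fin 3)} (hδ : δ ∈ fccSlots) (hstar : ∀ w ∈ fccSlots, 0 < ⟪w, δ⟫_ℝ → y + A w ∈ X)
    (h12 : (X.filter fun q => dist y q = 1).card = 12) :
    (∀ q ∈ X, dist y q = 1 → ∃ w ∈ fccSlots, q = y + A w) ∨
      ∃ n : EuclideanSpace ℝ (Fin 3), IsMenuNormal A n ∧
        (∀ w ∈ fccSlots, ⟪A w, n⟫_ℝ ≤ 0 → y + A w ∈ X) ∧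
        ∀ q ∈ X, dist y q = 1 →
          (∃ w ∈ fccSlots, ⟪A w, n⟫_ℝ ≤ 0 ∧ q = y + A w) ∨
            ∃ w ∈ fccSlots, ⟪A w, n⟫_ℝ < 0 ∧ q = y + (A w - (2 * ⟪A w, n⟫_ℝ) • n) := by
  classical
  -- slot balls are contacts (`dist_slotSite_eq_one`, …EndBallDefectSite, inlined to keep the import closure small)
  have hslot1 : ∀ {w}, w ∈ fccSlots → dist y (y + A w) = 1 := fun {w} hw => by
    rw [dist_eq_norm, sub_add_cancel_left, norm_neg, LinearIsometryEquiv.norm_map, norm_eq_one_of_mem_fccSlots hw]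
  set N := X.filter fun q => dist y q = 1 with hN
  -- the shell is a kissing arrangement containing the transported star
  have hkiss : IsKissingAround y N :=
    ⟨fun s hs => (mem_filter.1 hs).2, fun s hs t ht hst => hX s (mem_filter.1 hs).1 t (mem_filter.1 ht).1 hst⟩
  set O := (fccSlots.filter fun w => 0 < ⟪w, δ⟫_ℝ).image fun w => y + A w with hO
  have hON : O ⊆ N := by
    intro q hq
    obtain ⟨w, hw, rfl⟩ := mem_image.1 hq
    obtain ⟨hw, hpos⟩ := mem_filter.1 hw
    exact mem_filter.2 ⟨hstar w hw hpos, hslot1 hw⟩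
  obtain ⟨s₀, hs₀, h0⟩ := exactOnly_star_of_p5Exhaustion hE1
  have hEO : ExactOnly y O := exactOnly_star_transport hs₀ h0 A y hδ
  obtain ⟨B, hB⟩ := hEO N hON h12 hkiss
  -- members of the shell, as vectors from `y`
  have memN : ∀ {w}, w ∈ fccSlots → y + A w ∈ X → y + A w ∈ N := fun hw hx => mem_filter.2 ⟨hx, hslot1 hw⟩
  have vecOf : ∀ (P : Finset (EuclideanSpace ℝ (Fin 3))),
      (↑N : Set (EuclideanSpace ℝ (Fin 3))) = (fun p => B p + y) '' (↑P : Set (EuclideanSpace ℝ (Fin 3))) →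
      ∀ {q}, q ∈ N → q - y ∈ B '' (↑P : Set (EuclideanSpace ℝ (Fin 3))) := by
    intro P hP q hq
    have : q ∈ (fun p => B p + y) '' (↑P : Set (EuclideanSpace ℝ (Fin 3))) := by rw [← hP]; exact hq
    obtain ⟨p, hp, hpq⟩ := this
    exact ⟨p, hp, by rw [← hpq, add_sub_cancel_right]⟩
  have slotVec : ∀ (P : Finset (EuclideanSpace ℝ (Fin 3))),
      (↑N : Set (EuclideanSpace ℝ (Fin 3))) = (fun p => B p + y) '' (↑P : Set (EuclideanSpace ℝ (Fin 3))) →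
      ∀ {w}, w ∈ fccSlots → y + A w ∈ X → A w ∈ B '' (↑P : Set (EuclideanSpace ℝ (Fin 3))) := by
    intro P hP w hw hx
    have := vecOf P hP (memN hw hx)
    rwa [add_sub_cancel_left] at this
  -- three independent star slots: `δ` and a slot triangle through it
  obtain ⟨u₁, hu₁, u₂, hu₂, hd1, hd2, h12'⟩ := exists_slot_triangle hδ
  have hδX : y + A δ ∈ X := hstar δ hδ (by
    rw [real_inner_self_eq_norm_sq, norm_eq_one_of_mem_fccSlots hδ]; norm_num)
  have hu₁X : y + A u₁ ∈ X := hstar u₁ hu₁ (by rw [real_inner_comm, hd1]; norm_num)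
  have hu₂X : y + A u₂ ∈ X := hstar u₂ hu₂ (by rw [real_inner_comm, hd2]; norm_num)
  have slotA : ∀ {w}, w ∈ fccSlots → A w ∈ A '' (↑fccSlots : Set (EuclideanSpace ℝ (Fin 3))) :=
    fun {w} hw => ⟨w, hw, rfl⟩
  have fccA : ∀ {w}, w ∈ fccSlots → A w ∈ A '' fccStacking 1 (Real.sqrt (2 / 3)) :=
    fun {w} hw => ⟨w, mem_fcc_of_mem_fccSlots hw, rfl⟩
  have nA : ∀ {w}, w ∈ fccSlots → ‖A w‖ = 1 := fun {w} hw => by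
    rw [LinearIsometryEquiv.norm_map, norm_eq_one_of_mem_fccSlots hw]
  have hind : LinearIndependent ℝ ![A δ, A u₁, A u₂] :=
    linearIndependent_of_movedFcc_pairwise_half A (fccA hδ) (fccA hu₁) (fccA hu₂) (nA hδ) (nA hu₁) (nA hu₂)
      (by rw [LinearIsometryEquiv.inner_map_map, hd1]) (by rw [LinearIsometryEquiv.inner_map_map, hd2])
      (by rw [LinearIsometryEquiv.inner_map_map, h12'])
  rcases hB with hB | hB
  · -- fcc type: the shell is the slot dozen
    left
    have heq := fccDozen_eq_slots_of_three_independent A B (slotVec _ hB hδ hδX) (slotVec _ hB hu₁ hu₁X)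
      (slotVec _ hB hu₂ hu₂X) (slotA hδ) (slotA hu₁) (slotA hu₂) hind
    intro q hq hqd
    have hv := vecOf _ hB (mem_filter.2 ⟨hq, hqd⟩)
    rw [heq] at hv
    obtain ⟨w, hw, hwq⟩ := hv
    exact ⟨w, hw, by rw [hwq, add_sub_cancel]⟩
  · -- hcp type: a twin dozen
    right
    obtain ⟨n, hn1, hmenu, heq⟩ := hcpDozen_twin_of_three_independent A B (slotVec _ hB hδ hδX)
      (slotVec _ hB hu₁ hu₁X) (slotVec _ hB hu₂ hu₂X) (slotA hδ) (slotA hu₁) (slotA hu₂) hind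
    refine ⟨n, ⟨hn1, hmenu⟩, ?_, ?_⟩
    · -- the own part is occupied
      intro w hw hle
      have hmem : A w ∈ B '' (↑hcpKissingPattern : Set (EuclideanSpace ℝ (Fin 3))) := by
        rw [heq]; exact Or.inl ⟨w, ⟨hw, hle⟩, rfl⟩
      obtain ⟨p, hp, hpw⟩ := hmem
      have : y + A w ∈ N := by
        have : B p + y ∈ (fun p => B p + y) '' (↑hcpKissingPattern : Set (EuclideanSpace ℝ (Fin 3))) := ⟨p, hp, rfl⟩
        rw [← hB] at this
        rw [← hpw, add_comm]; exact this
      exact (mem_filter.1 this).1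
    · intro q hq hqd
      have hv := vecOf _ hB (mem_filter.2 ⟨hq, hqd⟩)
      rw [heq] at hv
      rcases hv with ⟨w, ⟨hw, hle⟩, hwq⟩ | ⟨w, ⟨hw, hlt⟩, hwq⟩
      · have hwq' : A w = q - y := hwq
        exact Or.inl ⟨w, hw, hle, by rw [hwq', add_sub_cancel]⟩
      · have hwq' : A w - (2 * ⟪A w, n⟫_ℝ) • n = q - y := hwq
        exact Or.inr ⟨w, hw, hlt, by rw [hwq', add_sub_cancel]⟩

/-- **EVERY CONTACT OF A SATURATED BALL OVER A SLOT STAR IS A SLOT BALL OR CAPS A SLOT TRIANGLE.**  Same hypotheses; for every contact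
`q` of `y`: either `q = y + A w` for a slot `w`, or there are slots `h₁, h₂` with `⟪h₁, h₂⟫ = ½`, `y + A h₁ ∈ X`, `y + A h₂ ∈ X` and
`dist q (y + A h₁) = dist q (y + A h₂) = 1` — `q` caps the occupied unit triangle `{y, y + A h₁, y + A h₂} ⊆ X`. -/
theorem contact_slot_or_caps_of_star_twelve (hE1 : P5Exhaustion)
    (A : EuclideanSpace ℝ (Fin 3) ≃ₗᵢ[ℝ] EuclideanSpace ℝ (Fin 3)) {X : Finset (EuclideanSpace ℝ (Fin 3))}
    (hX : ∀ p ∈ X, ∀ q ∈ X, p ≠ q → 1 ≤ dist p q) {y : EuclideanSpace ℝ (Fin 3)}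
    {δ : EuclideanSpace ℝ (Fin 3)} (hδ : δ ∈ fccSlots) (hstar : ∀ w ∈ fccSlots, 0 < ⟪w, δ⟫_ℝ → y + A w ∈ X)
    (h12 : (X.filter fun q => dist y q = 1).card = 12) {q : EuclideanSpace ℝ (Fin 3)} (hq : q ∈ X) (hqd : dist y q = 1) :
    (∃ w ∈ fccSlots, q = y + A w) ∨
      ∃ h₁ ∈ fccSlots, ∃ h₂ ∈ fccSlots, ⟪h₁, h₂⟫_ℝ = 1 / 2 ∧ y + A h₁ ∈ X ∧ y + A h₂ ∈ X ∧
        dist q (y + A h₁) = 1 ∧ dist q (y + A h₂) = 1 := by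
  classical
  rcases shell_slots_or_twin_of_star_twelve hE1 A hX hδ hstar h12 with h | ⟨n, hn, hown, h⟩
  · exact Or.inl (h q hq hqd)
  · rcases h q hq hqd with ⟨w, hw, -, hwq⟩ | ⟨w, hw, hlt, hwq⟩
    · exact Or.inl ⟨w, hw, hwq⟩
    · right
      obtain ⟨h₁, hh₁, h₂, hh₂, hw1, hw2, hh12, hn1, hn2⟩ := exists_inplane_slot_triangle A hn hw hlt
      refine ⟨h₁, hh₁, h₂, hh₂, hh12, hown h₁ hh₁ hn1.le, hown h₂ hh₂ hn2.le, ?_, ?_⟩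
      · rw [hwq]; exact dist_mirror_slot_eq_one A y hn.1 hw hh₁ hw1 hn1
      · rw [hwq]; exact dist_mirror_slot_eq_one A y hn.1 hw hh₂ hw2 hn2

/-- **Corollary (the E1 cap row in packing form).**  Same hypotheses except saturation: if some contact of `y` is NEITHER a slot ball
NOR a cap of an occupied slot triangle at `y`, then `y` has at most eleven contacts. -/
theorem card_contacts_le_eleven_of_foreign_contact (hE1 : P5Exhaustion)
    (A : EuclideanSpace ℝ (Fin 3) ≃ₗᵢ[ℝ] EuclideanSpace ℝ (Fin 3)) {X : Finset (EuclideanSpace ℝ (Fin 3))}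
    (hX : ∀ p ∈ X, ∀ q ∈ X, p ≠ q → 1 ≤ dist p q) {y : EuclideanSpace ℝ (Fin 3)}
    {δ : EuclideanSpace ℝ (Fin 3)} (hδ : δ ∈ fccSlots) (hstar : ∀ w ∈ fccSlots, 0 < ⟪w, δ⟫_ℝ → y + A w ∈ X)
    {q : EuclideanSpace ℝ (Fin 3)} (hq : q ∈ X) (hqd : dist y q = 1)
    (hns : ∀ w ∈ fccSlots, q ≠ y + A w)
    (hnc : ∀ h₁ ∈ fccSlots, ∀ h₂ ∈ fccSlots, ⟪h₁, h₂⟫_ℝ = 1 / 2 → y + A h₁ ∈ X → y + A h₂ ∈ X →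
      dist q (y + A h₁) = 1 → dist q (y + A h₂) ≠ 1) :
    (X.filter fun p => dist y p = 1).card ≤ 11 := by
  classical
  have h12 := card_filter_dist_eq_one_le_twelve X hX y
  by_contra hgt
  have heq : (X.filter fun p => dist y p = 1).card = 12 := by omega
  rcases contact_slot_or_caps_of_star_twelve hE1 A hX hδ hstar heq hq hqd with ⟨w, hw, hwq⟩ | ⟨h₁, hh₁, h₂, hh₂, hh, hx₁, hx₂, hd₁, hd₂⟩
  · exact hns w hw hwq
  · exact hnc h₁ hh₁ h₂ hh₂ hh hx₁ hx₂ hd₁ hd₂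

end Summit.Ventures.Crystal3D.Theorems

end
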